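import Summits.Ventures.HSemireg.WedgeHankelRecurrenceGaussChebyshevOddDenominatorProducts

/-!
# Venture HSemireg — **THE LEVEL SETS OF `C_n` AND `T_n` AT EVERY PHASE: `C_n − 2cos φ = ∏_{j<n} (X − 2cos((φ + 2πj)∕n))`, `2(T_n − cos φ) = 2ⁿ ∏_{j<n} (X − cos((φ + 2πj)∕n))` over `ℝ` for ALL
# `φ ∈ ℝ`, `n ≥ 1`** (no `sin φ ≠ 0` restriction: at `φ ∈ πℤ` the repeated factors are the double roots of N502 ∕ N504), the root multisets `(C_n − 2cos φ).roots = {2cos((φ + 2πj)∕n) : j < n}`,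
# `(T_n − cos φ).roots = {cos((φ + 2πj)∕n) : j < n}`, and the constant term **`∏_{j<n} 2cos((φ + 2πj)∕n) = (−1)ⁿ (C_n(0) − 2cos φ)`** (`= 2cos φ` for odd `n`) — from the roots-of-unity factorisation
# N507 with the unit `a = e^{iφ∕n}` (`aⁿ + a⁻ⁿ = 2cos φ`, `ζʲa + (ζʲa)⁻¹ = 2cos((φ + 2πj)∕n)`)

HONEST FRAMING. Part of the Lean index of the computation cell `pub-hsemireg` (seat p10 gen 49, Sunday typer «UNIFORM-IN-n»).  Polynomial algebra over `ℝ ⊂ ℂ` and `Complex.exp` only; no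
variety, no cohomology theory, no sheaf, no Ext group and no semiregularity map is constructed here; nothing here says that HC / HC_CM / HC_AV holds; no Literature fact (unproved `Prop`) is
declared or used.  Custodian versions as in `WedgeHankelSiegelIdeal` (1/3).
SOURCES (cited).  R. Lidl, G. L. Mullen, G. Turnwald, *Dickson Polynomials* (1993), Thm 3.12 (`D_n(x, a) − D_n(c, a)` splits over the roots of unity); T. J. Rivlin, *The Chebyshev Polynomials* (1974), §1.2
and Ex. 1.2.4 (`T_n(x) = c`); I. S. Gradshteyn, I. M. Ryzhik, *Table of Integrals, Series, and Products*, §1.39 (products `∏ cos(x + 2πk∕n)`).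
PROOF TYPED HERE.  N507 `chebyshevC_sub_C_eq_prod_of_isPrimitiveRoot` over `ℂ` with `ζ = e^{2πi∕n}` (Mathlib `Complex.isPrimitiveRoot_exp`) and `a = e^{iφ∕n}`; `z + z⁻¹ = 2cos w` for `z = e^{iw}`
(`Complex.two_cos`, `Complex.exp_neg`); `Complex.exp_nat_mul`, `Complex.exp_add`; descent `ℝ[X] ↪ ℂ[X]` (`Polynomial.map_injective`, `Polynomial.Chebyshev.map_C`); dilation `C_n(2X) = 2T_n` as in N509;
constant term by evaluating at `0` (`eval_prod`, `Finset.prod_neg`... via `(0 − r) = −r`).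
DEDUP DISCLOSURE (`rg -n 'AllPhases|two_mul_cos_eq_prod|prod_two_mul_cos_add' Summits Literature`, `lean search`, 2026-09-04): N506 gives the root multiset for `sin φ ≠ 0` (with `Nodup`), N508 ∕ N509
the `φ ∈ {0, π}` products; the all-phase products and the constant-term identity below are not in the tree or Mathlib; the auxiliary identity `e^{iw} + e^{−iw} = 2cos w` exists as
`Literature.NumberTheory.Automorphic.PicardSexticDatum.exp_mul_I_add_inv` (heavy imports) and is therefore inlined as a local `have`, not redeclared; 0 hits for the 7 names below.

WHAT IS IN THE TREE.  N507; N508 (`exp_units_pow_add_inv`, method); Mathlib `Complex.isPrimitiveRoot_exp`, `Complex.two_cos`, `Polynomial.map_injective`, `C_comp_two_mul_X`, `roots_multiset_prod_X_sub_C`.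
THIS FILE (namespace `Summit.Ventures.HSemireg.Wedge.HankelOuter` continued; CHAINED on N516; 0 definitions):
* §1282 **`chebyshevC_sub_C_two_mul_cos_eq_prod_complex`**, **`chebyshevC_sub_C_two_mul_cos_eq_prod_real`** (all `φ`),
  **`chebyshevC_sub_C_two_mul_cos_roots_real_all`**, **`two_mul_chebyshevT_sub_C_cos_eq_prod_real`**, **`chebyshevT_sub_C_cos_roots_real_all`**, **`prod_two_mul_cos_add_eq`**
  (`∏_{j<n} 2cos((φ + 2πj)∕n) = (−1)ⁿ(C_n(0) − 2cos φ)`), **`prod_two_mul_cos_add_eq_of_odd`** (`= 2cos φ` for odd `n`).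
CAVEATS.  `n ≥ 1`.  Nothing Ext-side.  New names only.
-/

open Module Polynomial
open scoped Matrix Polynomial

namespace Summit.Ventures.HSemireg.Wedge.HankelOuter

/-! ## §1282. Level sets at every phase -/

/-- **`C_n − 2cos φ = ∏_{j<n} (X − 2cos((φ + 2πj)∕n))` in `ℂ[X]`** for every `φ ∈ ℝ` (`n ≥ 1`). [Lidl–Mullen–Turnwald Thm 3.12; this file, §1282] -/
theorem chebyshevC_sub_C_two_mul_cos_eq_prod_complex {n : ℕ} (hn : n ≠ 0) (φ : ℝ) :
    Polynomial.Chebyshev.C ℂ (n : ℤ) - Polynomial.C (((2 * Real.cos φ : ℝ)) : ℂ) =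
      ∏ j ∈ Finset.range n, (Polynomial.X - Polynomial.C (((2 * Real.cos ((φ + 2 * Real.pi * j) / n) : ℝ)) : ℂ)) := by
  have hnC : (n : ℂ) ≠ 0 := by exact_mod_cast hn
  -- `e^{iw} + e^{−iw} = 2cos w` (the same two-line identity is `Literature…PicardSexticDatum.exp_mul_I_add_inv`; inlined here rather than importing that module)
  have exp_mul_I_add_inv : ∀ w : ℝ, Complex.exp (w * Complex.I) + (Complex.exp (w * Complex.I))⁻¹ = ((2 * Real.cos w : ℝ) : ℂ) := fun w => by
    rw [← Complex.exp_neg, Complex.ofReal_mul, Complex.ofReal_ofNat, Complex.ofReal_cos, Complex.two_cos, neg_mul]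
  set ζ : ℂˣ := Units.mk0 (Complex.exp ((2 * Real.pi / n : ℝ) * Complex.I)) (Complex.exp_ne_zero _) with hζdef
  set a : ℂˣ := Units.mk0 (Complex.exp ((φ / n : ℝ) * Complex.I)) (Complex.exp_ne_zero _) with hadef
  have hζ : IsPrimitiveRoot ζ n := by
    rw [← IsPrimitiveRoot.coe_units_iff, hζdef, Units.val_mk0, show (((2 * Real.pi / n : ℝ)) : ℂ) * Complex.I = 2 * Real.pi * Complex.I / n by push_cast; ring]
    exact Complex.isPrimitiveRoot_exp n hn
  have h := chebyshevC_sub_C_eq_prod_of_isPrimitiveRoot (Nat.pos_of_ne_zero hn) hζ a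
  -- `aⁿ + a⁻ⁿ = 2cos φ`
  have han : (((a ^ n : ℂˣ)) : ℂ) + (((a ^ n)⁻¹ : ℂˣ) : ℂ) = ((2 * Real.cos φ : ℝ) : ℂ) := by
    rw [Units.val_inv_eq_inv_val, Units.val_pow_eq_pow_val, hadef, Units.val_mk0, ← Complex.exp_nat_mul, show (n : ℂ) * ((((φ / n : ℝ)) : ℂ) * Complex.I) = (φ : ℝ) * Complex.I by push_cast; field_simp,
      exp_mul_I_add_inv]
  -- `ζʲ a + (ζʲ a)⁻¹ = 2cos((φ + 2πj)/n)`
  have hj : ∀ j : ℕ, (((ζ ^ j * a : ℂˣ)) : ℂ) + (((ζ ^ j * a)⁻¹ : ℂˣ) : ℂ) = ((2 * Real.cos ((φ + 2 * Real.pi * j) / n) : ℝ) : ℂ) := fun j => by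
    rw [Units.val_inv_eq_inv_val, Units.val_mul, Units.val_pow_eq_pow_val, hζdef, hadef, Units.val_mk0, Units.val_mk0, ← Complex.exp_nat_mul, ← Complex.exp_add,
      show (j : ℂ) * ((((2 * Real.pi / n : ℝ)) : ℂ) * Complex.I) + (((φ / n : ℝ)) : ℂ) * Complex.I = (((φ + 2 * Real.pi * j) / n : ℝ) : ℂ) * Complex.I by push_cast; field_simp; ring,
      exp_mul_I_add_inv]
  rw [han] at h
  rw [h]
  exact Finset.prod_congr rfl fun j _ => by rw [hj]

/-- **`C_n − 2cos φ = ∏_{j<n} (X − 2cos((φ + 2πj)∕n))` in `ℝ[X]`** for every `φ ∈ ℝ` (`n ≥ 1`). [Lidl–Mullen–Turnwald Thm 3.12; Rivlin §1.2; this file, §1282] -/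
theorem chebyshevC_sub_C_two_mul_cos_eq_prod_real {n : ℕ} (hn : n ≠ 0) (φ : ℝ) :
    Polynomial.Chebyshev.C ℝ (n : ℤ) - Polynomial.C (2 * Real.cos φ) = ∏ j ∈ Finset.range n, (Polynomial.X - Polynomial.C (2 * Real.cos ((φ + 2 * Real.pi * j) / n))) := by
  apply Polynomial.map_injective (algebraMap ℝ ℂ) (RingHom.injective _)
  rw [Polynomial.map_sub, Polynomial.Chebyshev.map_C, Polynomial.map_C, show algebraMap ℝ ℂ (2 * Real.cos φ) = (((2 * Real.cos φ : ℝ)) : ℂ) from rfl,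
    chebyshevC_sub_C_two_mul_cos_eq_prod_complex hn φ, Polynomial.map_prod]
  refine Finset.prod_congr rfl fun j _ => ?_
  rw [Polynomial.map_sub, Polynomial.map_X, Polynomial.map_C]
  rfl

/-- **`(C_n − 2cos φ).roots = {2cos((φ + 2πj)∕n) : j < n}` over `ℝ`** for every `φ` (`n ≥ 1`; multiset — at `φ ∈ πℤ` interior values repeat, cf. N502). [Rivlin §1.2; this file, §1282] -/
theorem chebyshevC_sub_C_two_mul_cos_roots_real_all {n : ℕ} (hn : n ≠ 0) (φ : ℝ) :
    (Polynomial.Chebyshev.C ℝ (n : ℤ) - Polynomial.C (2 * Real.cos φ)).roots = (Multiset.range n).map fun j : ℕ => 2 * Real.cos ((φ + 2 * Real.pi * j) / n) := by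
  have h : (Multiset.range n).map (fun j : ℕ => Polynomial.X - Polynomial.C (2 * Real.cos ((φ + 2 * Real.pi * j) / n))) =
      ((Multiset.range n).map fun j : ℕ => 2 * Real.cos ((φ + 2 * Real.pi * j) / n)).map (fun a : ℝ => Polynomial.X - Polynomial.C a) := by rw [Multiset.map_map]; rfl
  rw [chebyshevC_sub_C_two_mul_cos_eq_prod_real hn, Finset.prod_eq_multiset_prod, Finset.range_val, h, roots_multiset_prod_X_sub_C]

/-- **`2(T_n − cos φ) = 2ⁿ ∏_{j<n} (X − cos((φ + 2πj)∕n))` in `ℝ[X]`** for every `φ` (`n ≥ 1`). [Rivlin §1.2, Ex. 1.2.4; this file, §1282] -/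
theorem two_mul_chebyshevT_sub_C_cos_eq_prod_real {n : ℕ} (hn : n ≠ 0) (φ : ℝ) :
    2 * (Polynomial.Chebyshev.T ℝ (n : ℤ) - Polynomial.C (Real.cos φ)) = Polynomial.C ((2 : ℝ) ^ n) * ∏ j ∈ Finset.range n, (Polynomial.X - Polynomial.C (Real.cos ((φ + 2 * Real.pi * j) / n))) := by
  have h := congrArg (fun p : ℝ[X] => p.comp (2 * Polynomial.X)) (chebyshevC_sub_C_two_mul_cos_eq_prod_real hn φ)
  simp only [sub_comp, Polynomial.Chebyshev.C_comp_two_mul_X, Polynomial.prod_comp, X_comp, C_comp] at h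
  rw [show Polynomial.C (2 * Real.cos φ) = 2 * Polynomial.C (Real.cos φ) by rw [map_mul, Polynomial.C_ofNat], ← mul_sub] at h
  rw [h, show (Polynomial.C ((2 : ℝ) ^ n)) = ∏ _j ∈ Finset.range n, Polynomial.C (2 : ℝ) by rw [Finset.prod_const, Finset.card_range, map_pow], ← Finset.prod_mul_distrib]
  refine Finset.prod_congr rfl fun j _ => ?_
  rw [map_mul, Polynomial.C_ofNat]
  ring

/-- **`(T_n − cos φ).roots = {cos((φ + 2πj)∕n) : j < n}` over `ℝ`** for every `φ` (`n ≥ 1`; multiset). [Rivlin §1.2; this file, §1282] -/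
theorem chebyshevT_sub_C_cos_roots_real_all {n : ℕ} (hn : n ≠ 0) (φ : ℝ) :
    (Polynomial.Chebyshev.T ℝ (n : ℤ) - Polynomial.C (Real.cos φ)).roots = (Multiset.range n).map fun j : ℕ => Real.cos ((φ + 2 * Real.pi * j) / n) := by
  have h2 : (Polynomial.Chebyshev.T ℝ (n : ℤ) - Polynomial.C (Real.cos φ)) = Polynomial.C ((2 : ℝ) ^ n / 2) * ∏ j ∈ Finset.range n, (Polynomial.X - Polynomial.C (Real.cos ((φ + 2 * Real.pi * j) / n))) := by
    apply mul_left_cancel₀ (two_ne_zero : (2 : ℝ[X]) ≠ 0)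
    rw [two_mul_chebyshevT_sub_C_cos_eq_prod_real hn, ← mul_assoc, ← Polynomial.C_ofNat, ← map_mul, mul_div_cancel₀ _ (two_ne_zero : (2 : ℝ) ≠ 0)]
  have h : (Multiset.range n).map (fun j : ℕ => Polynomial.X - Polynomial.C (Real.cos ((φ + 2 * Real.pi * j) / n))) =
      ((Multiset.range n).map fun j : ℕ => Real.cos ((φ + 2 * Real.pi * j) / n)).map (fun a : ℝ => Polynomial.X - Polynomial.C a) := by rw [Multiset.map_map]; rfl
  rw [h2, roots_C_mul _ (div_ne_zero (pow_ne_zero _ two_ne_zero) two_ne_zero), Finset.prod_eq_multiset_prod, Finset.range_val, h, roots_multiset_prod_X_sub_C]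

/-- **`∏_{j<n} 2cos((φ + 2πj)∕n) = (−1)ⁿ (C_n(0) − 2cos φ)`** (`n ≥ 1`; `C_n(0) = 2cos(nπ∕2)`: `0` for odd `n`, `2(−1)^{n∕2}` for even `n`). [Gradshteyn–Ryzhik §1.39; this file, §1282] -/
theorem prod_two_mul_cos_add_eq {n : ℕ} (hn : n ≠ 0) (φ : ℝ) :
    ∏ j ∈ Finset.range n, 2 * Real.cos ((φ + 2 * Real.pi * j) / n) = (-1) ^ n * ((Polynomial.Chebyshev.C ℝ (n : ℤ)).eval 0 - 2 * Real.cos φ) := by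
  have h := congrArg (Polynomial.eval (0 : ℝ)) (chebyshevC_sub_C_two_mul_cos_eq_prod_real hn φ)
  rw [eval_sub, eval_C, eval_prod] at h
  simp only [eval_sub, eval_X, eval_C, zero_sub, Finset.prod_neg, Finset.card_range] at h
  rw [h, ← mul_assoc, ← mul_pow, neg_one_mul, neg_neg, one_pow, one_mul]

/-- **Odd `n`: `∏_{j<n} 2cos((φ + 2πj)∕n) = 2cos φ`** (e.g. `4cos θ cos(θ + 2π∕3) cos(θ + 4π∕3) = cos 3θ`). [Gradshteyn–Ryzhik §1.39; this file, §1282] -/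
theorem prod_two_mul_cos_add_eq_of_odd {n : ℕ} (hn : Odd n) (φ : ℝ) : ∏ j ∈ Finset.range n, 2 * Real.cos ((φ + 2 * Real.pi * j) / n) = 2 * Real.cos φ := by
  have hC0 : (Polynomial.Chebyshev.C ℝ (n : ℤ)).eval 0 = 0 := by
    have h := congrArg (Polynomial.eval (0 : ℝ)) (Polynomial.Chebyshev.C_comp_two_mul_X ℝ (n : ℤ))
    rw [eval_comp, eval_mul, eval_ofNat, eval_X, mul_zero, eval_mul, eval_ofNat, Polynomial.Chebyshev.T_eval_zero_of_odd ℝ ((Int.odd_coe_nat n).mpr hn), mul_zero] at h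
    exact h
  rw [prod_two_mul_cos_add_eq hn.pos.ne' φ, hC0, zero_sub, hn.neg_one_pow]
  ring

end Summit.Ventures.HSemireg.Wedge.HankelOuter
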